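import Mathlib.RingTheory.Smooth.Field
import Mathlib.RingTheory.Kaehler.JacobiZariski
import Mathlib.RingTheory.AlgebraicIndependent.TranscendenceBasis
import Mathlib.Algebra.MvPolynomial.PDeriv
import Mathlib.Algebra.MvPolynomial.Derivation
import Mathlib.RingTheory.Derivation.Basic
import Mathlib.LinearAlgebra.Basis.VectorSpace
import Mathlib.FieldTheory.Perfect
import HarnessLib

/-!
# Extending derivations along field extensions of characteristic zero

Trunk T-TRANSCEND (`Literature/NumberTheory/Transcendental`). Support file (folklore commutative
algebra) for the discharge of the named facts `Literature.NumberTheory.Transcendental.Rosenlicht.Rosenlicht1976_prop4`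
(`RosenlichtDifferentials.lean`) and `Literature.NumberTheory.Transcendental.Kirby2010_dcl_subset_ecl` (`KirbyEDerivations.lean`),
both of which need a supply of derivations of a field of characteristic zero:

* `Literature.NumberTheory.Transcendental.formallySmooth_of_charZero`: an arbitrary extension `K/k` of fields of characteristic zero
  is formally smooth (it is separably generated: a transcendence basis followed by a separable
  algebraic extension; Mathlib has both halves).
* `Literature.NumberTheory.Transcendental.mapBaseChange_injective_of_formallySmooth`: for `R → S → T` with `T` formally smooth over
  `S`, the map `T ⊗[S] Ω[S⁄R] → Ω[T⁄R]` is injective (`H₁(L_{T/S}) = 0` and the Jacobi–Zariski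
  sequence).
* `Literature.NumberTheory.Transcendental.Derivation.exists_extension_of_formallySmooth`: hence every `R`-derivation of `S` into a
  `T`-vector space (`T` a field, formally smooth over `S`) extends to an `R`-derivation of `T`; in
  particular (`exists_extension_of_charZero`) derivations extend along arbitrary extensions of
  fields of characteristic zero (Rosenlicht 1976, Prop. 3, Corollary: "`Ω_{K/k} → Ω_{L/k}` is
  injective", dual form).
* `Literature.NumberTheory.Transcendental.exists_derivation_of_forall_aeval` : the derivations of `K/k` with prescribed values `vᵢ` on
  a family `x : σ → K` exist as soon as the values are compatible with the algebraic relations of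
  `x` over `k` (`P(x) = 0 ⟹ Σᵢ (∂ᵢP)(x) vᵢ = 0`); in particular (`exists_derivation_of_
  algebraicIndependent`) an algebraically independent family admits derivations with arbitrary
  prescribed values ("`∂/∂xᵢ`"; Rosenlicht 1976, Prop. 3: "`{dx_α}` is a basis of `Ω_{K/k}`").

## References

* M. Rosenlicht, *On Liouville's theory of elementary functions*, Pacific J. Math. 65 (1976),
  485–492, Prop. 3 and its Corollary (p. 487).
* A. Grothendieck, EGA 0_IV (1964), 19.6.1, 20.5.7 (formal smoothness of separable field
  extensions; extension of derivations).
-/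

noncomputable section

open KaehlerDifferential TensorProduct MvPolynomial

namespace Literature.NumberTheory.Transcendental

/-! ### Formal smoothness of characteristic-zero field extensions -/

/-- An extension of fields of characteristic zero is formally smooth: it is separably generated
(a transcendence basis `s`, then `K` is algebraic, hence separable, over `k(s)`).
[cite: EGA0IV, Thm. 19.6.1] [folklore] -/
theorem formallySmooth_of_charZero (k K : Type*) [Field k] [CharZero k] [Field K] [Algebra k K] :
    Algebra.FormallySmooth k K := by
  obtain ⟨s, hs⟩ := exists_isTranscendenceBasis k K
  haveI : CharZero K := charZero_of_injective_algebraMap (algebraMap k K).injective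
  haveI := hs.isAlgebraic_field
  haveI : CharZero (IntermediateField.adjoin k (Set.range ((↑) : s → K))) :=
    (algebraMap (IntermediateField.adjoin k (Set.range ((↑) : s → K))) K).charZero
  haveI : Algebra.IsSeparable (IntermediateField.adjoin k (Set.range ((↑) : s → K))) K :=
    inferInstance
  exact Algebra.FormallySmooth.of_algebraicIndependent_of_isSeparable hs.1

/-! ### Injectivity of `T ⊗ Ω[S⁄R] → Ω[T⁄R]` and extension of derivations -/

/-- For algebras `R → S → T` with `T` formally smooth over `S`, the base-changed differential map
`T ⊗[S] Ω[S⁄R] → Ω[T⁄R]` is injective: its kernel is the image of `H₁(L_{T/S}) = 0`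
(Jacobi–Zariski). [cite: EGA0IV, Thm. 20.5.7] [folklore] -/
theorem mapBaseChange_injective_of_formallySmooth (R S T : Type*) [CommRing R] [CommRing S]
    [CommRing T] [Algebra R S] [Algebra R T] [Algebra S T] [IsScalarTower R S T]
    [Algebra.FormallySmooth S T] :
    Function.Injective (KaehlerDifferential.mapBaseChange R S T) := by
  rw [injective_iff_map_eq_zero]
  intro x hx
  obtain ⟨y, rfl⟩ := (Algebra.H1Cotangent.exact_δ_mapBaseChange R S T x).mp hx
  rw [Subsingleton.elim y 0, map_zero]

/-- **Extension of derivations along formally smooth maps into a field.** If `T` is a field,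
formally smooth over `S`, then every `R`-derivation `d : S → M` into a `T`-vector space `M`
extends to an `R`-derivation `d' : T → M` (`d' ∘ algebraMap = d`): factor `d` through
`Ω[S⁄R]`, base-change to `T ⊗[S] Ω[S⁄R] ↪ Ω[T⁄R]` (injective by formal smoothness, hence split
over the field `T`) and compose with the universal derivation of `T`.
[cite: EGA0IV, Thm. 20.5.7] [folklore] -/
theorem Derivation.exists_extension_of_formallySmooth {R S T M : Type*} [CommRing R]
    [CommRing S] [Field T] [Algebra R S] [Algebra R T] [Algebra S T] [IsScalarTower R S T]
    [Algebra.FormallySmooth S T] [AddCommGroup M] [Module R M] [Module S M] [Module T M]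
    [IsScalarTower S T M] [IsScalarTower R S M] [IsScalarTower R T M] (d : Derivation R S M) :
    ∃ d' : Derivation R T M, ∀ s : S, d' (algebraMap S T s) = d s := by
  have hinj := mapBaseChange_injective_of_formallySmooth R S T
  obtain ⟨π, hπ⟩ := LinearMap.exists_leftInverse_of_injective
    (KaehlerDifferential.mapBaseChange R S T) (LinearMap.ker_eq_bot.mpr hinj)
  let g : T ⊗[S] Ω[S⁄R] →ₗ[T] M := (d.liftKaehlerDifferential).liftBaseChange T
  refine ⟨(g ∘ₗ π).compDer (KaehlerDifferential.D R T), fun s => ?_⟩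
  have h1 : KaehlerDifferential.D R T (algebraMap S T s) =
      KaehlerDifferential.mapBaseChange R S T (1 ⊗ₜ KaehlerDifferential.D R S s) := by
    rw [KaehlerDifferential.mapBaseChange_tmul, one_smul, KaehlerDifferential.map_D]
  show g (π (KaehlerDifferential.D R T (algebraMap S T s))) = d s
  rw [h1, ← LinearMap.comp_apply (f := π), hπ, LinearMap.id_apply]
  simp [g, LinearMap.liftBaseChange_tmul]

/-- Derivations extend along arbitrary extensions of fields of characteristic zero: for fields
`F ⊆ T` of characteristic zero (`Algebra F T`) over a base ring `R`, every `R`-derivation of `F`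
into a `T`-vector space extends to `T`. (Rosenlicht 1976, Corollary to Prop. 3, in dual form.)
[cite: Rosenlicht1976, Prop. 3, Corollary] [folklore] -/
theorem Derivation.exists_extension_of_charZero {R F T M : Type*} [CommRing R] [Field F]
    [CharZero F] [Field T] [Algebra R F] [Algebra R T] [Algebra F T] [IsScalarTower R F T]
    [AddCommGroup M] [Module R M] [Module F M] [Module T M] [IsScalarTower F T M]
    [IsScalarTower R F M] [IsScalarTower R T M] (d : Derivation R F M) :
    ∃ d' : Derivation R T M, ∀ s : F, d' (algebraMap F T s) = d s := by
  haveI := formallySmooth_of_charZero F T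
  exact Derivation.exists_extension_of_formallySmooth d

/-! ### Derivations with prescribed values -/

section Prescribed

variable {k K : Type*} [Field k] [CharZero k] [Field K] [Algebra k K] {σ : Type*}

omit [CharZero k] in
/-- The chain rule for the derivation `mkDerivation k v` of `k[X_σ]` into a module over the
polynomial ring: `∂P = Σᵢ (∂P/∂Xᵢ) • vᵢ` (finite sum over the variables of `P`). [folklore] -/
theorem mkDerivation_apply_eq_sum [Fintype σ] {A : Type*} [AddCommGroup A]
    [Module (MvPolynomial σ k) A] [Module k A] [IsScalarTower k (MvPolynomial σ k) A]
    (v : σ → A) (P : MvPolynomial σ k) :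
    MvPolynomial.mkDerivation k v P = ∑ i, (pderiv i P) • v i := by
  classical
  induction P using MvPolynomial.induction_on with
  | C a =>
    have : MvPolynomial.mkDerivation k v (C a) = 0 :=
      (MvPolynomial.mkDerivation k v).map_algebraMap a
    simp [this]
  | add p q hp hq => simp [hp, hq, Finset.sum_add_distrib, add_smul]
  | mul_X p i hp =>
    rw [Derivation.leibniz, hp, MvPolynomial.mkDerivation_X, Finset.smul_sum]
    have h : ∀ j, pderiv j (p * X i) = pderiv j p * X i + (if i = j then p else 0) := fun j => by
      rw [(pderiv j).leibniz, pderiv_X, smul_eq_mul, smul_eq_mul, Pi.single_apply]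
      split_ifs <;> ring
    simp_rw [h, add_smul, Finset.sum_add_distrib, ite_smul, zero_smul, Finset.sum_ite_eq,
      if_pos (Finset.mem_univ i)]
    rw [add_comm]
    congr 1
    exact Finset.sum_congr rfl fun j _ => by rw [mul_comm, mul_smul]

/-- **Derivations with prescribed values.** Let `x : σ → K` (`σ` finite) be elements of a field
extension `K/k` of characteristic zero and `v : σ → K` candidate values. If the values are
compatible with every algebraic relation of `x` over `k` — `P(x) = 0 ⟹ Σᵢ (∂ᵢP)(x) · vᵢ = 0` for
`P ∈ k[X_σ]` — then there is a `k`-derivation `D` of `K` with `D(xᵢ) = vᵢ`. Proof: the rule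
`P ↦ Σᵢ (∂ᵢP)(x) vᵢ` is a derivation of `k[X_σ]` into `K` killing the ideal of `x`, so it
descends to `k[x] ⊆ K`, extends to the fraction field `k(x)` (a localisation, formally smooth)
and then to `K` (`Derivation.exists_extension_of_charZero`). [folklore] -/
theorem exists_derivation_of_forall_aeval [Fintype σ] (x : σ → K) (v : σ → K)
    (hv : ∀ P : MvPolynomial σ k, aeval x P = 0 → ∑ i, aeval x (pderiv i P) * v i = 0) :
    ∃ D : Derivation k K K, ∀ i, D (x i) = v i := by
  classical
  -- `K` as a module over the polynomial ring through evaluation at `x`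
  letI inst : Module (MvPolynomial σ k) K := Module.compHom K (MvPolynomial.aeval x).toRingHom
  have hsmul : ∀ (P : MvPolynomial σ k) (m : K), P • m = aeval x P * m := fun _ _ => rfl
  haveI : IsScalarTower k (MvPolynomial σ k) K :=
    ⟨fun a P m => by rw [hsmul, hsmul, map_smul, Algebra.smul_def, Algebra.smul_def, mul_assoc]⟩
  let d₀ : Derivation k (MvPolynomial σ k) K := MvPolynomial.mkDerivation k v
  have hd₀ : ∀ P, d₀ P = ∑ i, aeval x (pderiv i P) * v i := fun P => by
    rw [show d₀ P = ∑ i, (pderiv i P) • v i from mkDerivation_apply_eq_sum v P]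
    exact Finset.sum_congr rfl fun i _ => hsmul _ _
  have hd₀X : ∀ i, d₀ (X i) = v i := fun i => MvPolynomial.mkDerivation_X k v i
  -- descend to `S = k[x]`
  set S : Subalgebra k K := Algebra.adjoin k (Set.range x) with hS
  have hsurj : ∀ s : S, ∃ P : MvPolynomial σ k, aeval x P = s := fun s => by
    have hs : (s : K) ∈ (aeval (R := k) x).range := by
      rw [← Algebra.adjoin_range_eq_range_aeval]
      exact s.2
    exact hs
  choose lift hlift using hsurj
  have hwd : ∀ P Q : MvPolynomial σ k, aeval x P = aeval x Q → d₀ P = d₀ Q := by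
    intro P Q h
    rw [← sub_eq_zero, ← map_sub, hd₀]
    exact hv _ (by rw [map_sub, h, sub_self])
  let dS : Derivation k S K :=
    { toFun := fun s => d₀ (lift s)
      map_add' := fun a b => by
        have : d₀ (lift (a + b)) = d₀ (lift a + lift b) :=
          hwd _ _ (by simp only [map_add, hlift, Subalgebra.coe_add])
        rw [this, map_add]
      map_smul' := fun r a => by
        have : d₀ (lift (r • a)) = d₀ (r • lift a) :=
          hwd _ _ (by simp only [map_smul, hlift, Subalgebra.coe_smul])
        rw [this, d₀.map_smul, RingHom.id_apply]
      map_one_eq_zero' := by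
        have : d₀ (lift 1) = d₀ 1 := hwd _ _ (by simp only [hlift, map_one, Subalgebra.coe_one])
        show d₀ (lift 1) = 0
        rw [this, d₀.map_one_eq_zero]
      leibniz' := fun a b => by
        have : d₀ (lift (a * b)) = d₀ (lift a * lift b) :=
          hwd _ _ (by simp only [map_mul, hlift, Subalgebra.coe_mul])
        show d₀ (lift (a * b)) = a • d₀ (lift b) + b • d₀ (lift a)
        rw [this, d₀.leibniz, hsmul, hsmul, hlift, hlift]
        rfl }
  have hdS : ∀ s, dS s = d₀ (lift s) := fun s => rfl
  -- extend to the fraction field `k(x)` and then to `K`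
  set L : IntermediateField k K := IntermediateField.adjoin k (Set.range x) with hL
  open scoped IntermediateField.algebraAdjoinAdjoin in
  haveI : Algebra.FormallySmooth S L := .of_isLocalization (nonZeroDivisors S)
  open scoped IntermediateField.algebraAdjoinAdjoin in
  obtain ⟨dL, hdL⟩ := Derivation.exists_extension_of_formallySmooth
    (R := k) (S := S) (T := L) (M := K) dS
  haveI : CharZero L := charZero_of_injective_algebraMap (algebraMap k L).injective
  obtain ⟨D, hD⟩ := Derivation.exists_extension_of_charZero (R := k) (F := L) (T := K) (M := K) dL
  refine ⟨D, fun i => ?_⟩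
  have hxS : x i ∈ S := Algebra.subset_adjoin ⟨i, rfl⟩
  have hxL : x i ∈ L := IntermediateField.subset_adjoin k _ ⟨i, rfl⟩
  open scoped IntermediateField.algebraAdjoinAdjoin in
  have h1 : (⟨x i, hxL⟩ : L) = algebraMap S L ⟨x i, hxS⟩ := Subtype.ext rfl
  have h2 : x i = algebraMap L K ⟨x i, hxL⟩ := rfl
  rw [h2, hD, h1, hdL, hdS]
  have h3 : d₀ (lift ⟨x i, hxS⟩) = d₀ (X i) := hwd _ _ (by rw [hlift, aeval_X])
  rw [h3, hd₀X]

/-- **`∂/∂xᵢ`.** An algebraically independent family `x : σ → K` (`σ` finite) over a field `k`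
of characteristic zero admits `k`-derivations of `K` with arbitrary prescribed values on `x`
(Rosenlicht 1976, Prop. 3: the `dx_α` of a transcendence basis form a basis of `Ω_{K/k}`; here
in dual form). [cite: Rosenlicht1976, Prop. 3] [folklore] -/
theorem exists_derivation_of_algebraicIndependent [Fintype σ] {x : σ → K}
    (hx : AlgebraicIndependent k x) (v : σ → K) :
    ∃ D : Derivation k K K, ∀ i, D (x i) = v i :=
  exists_derivation_of_forall_aeval x v fun P hP => by
    have : P = 0 := hx (by simpa using hP)
    simp [this]

/-- Elements outside the relative algebraic closure are moved by some derivation: if `t ∈ K` is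
transcendental over `k` (characteristic zero) then some `k`-derivation `D` of `K` has `D t = 1`.
[cite: Rosenlicht1976, Prop. 3] [folklore] -/
theorem exists_derivation_eq_one_of_transcendental {t : K} (ht : Transcendental k t) :
    ∃ D : Derivation k K K, D t = 1 := by
  have hx : AlgebraicIndependent k (fun _ : Unit => t) := by
    rw [algebraicIndependent_unique_type_iff]
    exact ht
  obtain ⟨D, hD⟩ := exists_derivation_of_algebraicIndependent hx fun _ => 1
  exact ⟨D, hD ()⟩

/-- **Enough derivations**: if the `k`-derivations of `K` form a finite-dimensional `K`-space,
then `trdeg_k K ≤ dim_K Der(K/k)` — the derivations `∂/∂xᵢ` dual to (finitely many elements of)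
a transcendence basis are linearly independent (Rosenlicht 1976, Prop. 3, dual form; in fact
equality holds). [cite: Rosenlicht1976, Prop. 3] [folklore] -/
theorem trdeg_le_finrank_derivation [Module.Finite K (Derivation k K K)] :
    Algebra.trdeg k K ≤ (Module.finrank K (Derivation k K K) : Cardinal) := by
  classical
  obtain ⟨s, hs⟩ := exists_isTranscendenceBasis k K
  -- every finite subset of `s` has at most `finrank` elements
  have hfin : ∀ t : Finset K, (↑t : Set K) ⊆ s → t.card ≤ Module.finrank K (Derivation k K K) := by
    intro t ht
    have hx : AlgebraicIndependent k ((↑) : t → K) := by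
      have := hs.1.comp (Set.inclusion ht) (Set.inclusion_injective ht)
      exact this
    choose D hD using fun i : t =>
      exists_derivation_of_algebraicIndependent hx (fun j => if j = i then (1 : K) else 0)
    have hli : LinearIndependent K D := by
      rw [Fintype.linearIndependent_iff]
      intro g hg i
      have := congrArg (fun E : Derivation k K K => E (i : K)) hg
      rw [← Derivation.coeFnAddMonoidHom_apply, map_sum, Finset.sum_apply] at this
      simp only [Derivation.coeFnAddMonoidHom_apply, Derivation.smul_apply, smul_eq_mul, hD,
        mul_ite, mul_one, mul_zero, Derivation.zero_apply] at this
      rwa [Finset.sum_ite_eq, if_pos (Finset.mem_univ i)] at this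
    simpa using hli.fintype_card_le_finrank
  -- hence `s` is finite, of cardinality at most `finrank`
  have hsfin : s.Finite := by
    by_contra hinf
    obtain ⟨t, hts, htc⟩ := Set.Infinite.exists_subset_card_eq hinf
      (Module.finrank K (Derivation k K K) + 1)
    have := hfin t hts
    omega
  rw [← hs.cardinalMk_eq_trdeg]
  haveI : Fintype s := hsfin.fintype
  rw [Cardinal.mk_fintype, ← Set.toFinset_card]
  exact_mod_cast hfin s.toFinset (by simp)

end Prescribed

end Literature.NumberTheory.Transcendental
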